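import Summits.NavierStokesRegularity.FluidComputer.PalasekTowerRegisterGlobalReball
import Literature.Analysis.FluidPDE.ClayDataSpaceShift
import Literature.Analysis.FluidPDE.ClassicalSolutionRescale
import Literature.Analysis.FluidPDE.LoopCirculation

/-!
# REGISTER v2.3′: the BALL LEVER for balls of ANY CENTRE — re-centring a registered design
# (`S ↦ S.translate c`, datum `x ↦ u₀ (c + x)`, force `(t, x) ↦ f t (c + x)`)

Cell `ns-blowup`, seat `ns-blowup-fc-prover-3` (g4; D-0074 GROUP C/E «BRIDGE SUPPORT»; bears_on LADDER-NS N1,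
route `PalasekTowerBreakdown`, child cruxes stmt-NavierStokesRegularity-19249 `HeredityAtOne`, -19250
`HeredityFromTwo`, parent -19178 — supported, NOT closed or claimed). Companion of
`PalasekTowerRegisterGlobalReball.lean` (this seat, p457497: `Schedule.reball`, `Schedule.ConfinedTo`,
`Schedule.ReadsIn`, `Stage.reball`, the lever for origin-centred balls), of the Literature plumbing
`ClayDataSpaceShift.lean` (`HasRapidSpatialDecay.spaceShift`, `IsSmoothOnHalfSpace.spaceShift`,
`HasRapidSpaceTimeDecay.spaceShift`) and `ClassicalSolutionRescale.lean`
(`IsClassicalNSSolutionOn.spaceTranslate`). LABEL: E–C typing (KERNEL: one more schedule transformer, one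
bookkeeping predicate, transport lemmas, and PROVED consequences of the OPEN `∀`-statements; no named fact,
no `sorry`). WHAT THIS IS NOT: not Navier–Stokes evidence — no stage, flow or tower is constructed or
claimed; `HeredityAt k` / `HeredityFrom k₀` appear only as HYPOTHESES, or negated in the conclusion of
refutation TEMPLATES whose premise is ONE EXHIBITED registered stage (none is known: vacuity stands).

## The lever, re-centred

The register's ball is `B̄(0, S.radius)`: centred at the ORIGIN of the schedule's coordinates. The forced
Navier–Stokes system has constant coefficients, Fefferman's datum/force classes are translation invariant,
Lebesgue measure is translation invariant, and NONE of `Rigid`, `Quiet`, the ceilings, the quiet clauses or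
the global anchor sees the origin. So the re-centred design `S.translate c` (same times and constants, datum
`x ↦ u₀ (c + x)`, force `(t, x) ↦ f t (c + x)`) is again a pinned rigid quiet schedule as soon as the new
ball confines datum and force, and a `routeG` stage of `S` re-registers for `(S.translate c).reball r` as
soon as its levels `j ≤ k` are read inside `B̄(c, r)` (`Stage.translate`). Since a registered stage PINS the
design's flow (`Stage.velocity_eq_of_classical`, W14-free), §3 gives:

**`HeredityAt.readsInBall`.** Under `HeredityAt k`, EVERY registered level-`(k+1)` stage of a pinned rigid
quiet wide design reads level `k + 1` at `τ (k+1)` (speed `≥ c₁ Y_{k+1}`, strain `≥ c₁ A_{k+1}`, an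
`N_{k+1}`-core) inside EVERY ball `B̄(c, r)` — ANY centre `c`, ANY radius `r`, no comparison with
`S.radius` — that confines `(u₀, f)` and in which the levels `j ≤ k` of some registered level-`k` stage are
read; cumulatively (`HeredityFrom.readsInBall_all`) the whole tower above `k₀` is read inside every such
ball reading the levels `≤ k₀`. Template `not_heredityAt_of_continuation_speed_lt_ball`: ONE registered
level-`k` stage, ONE admissible ball `B̄(c, r)`, and the design's own flow computed to `τ (k+1)` with speed
`< c₁ Y_{k+1}` throughout `B̄(c, r)` refutes `HeredityAt k` (MISSTATEMENT class: the register pins no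
centre and no return of the active structure to any ball; repair = a conclusion-side or level-indexed
radius, planner's call).

References: S. Palasek, arXiv:2605.13827 §3.3, §4 [cite: Palasek2026ElementaryModel, §3.3]; C. L.
Fefferman, Clay problem description, (4)–(5) [cite: FeffermanClay2006, (4)]; H. Sohr, *The Navier–Stokes
Equations*, Birkhäuser 2001, Ch. V Thm. 1.5.1 [cite: Sohr2001, Ch. V Thm. 1.5.1].
-/

noncomputable section

namespace Summit.NavierStokesRegularity.FluidComputer.PalasekTowerClayBridge

open Set MeasureTheory Filter Topology Function Real
open scoped ENNReal ContDiff NNReal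
open Literature.Analysis.FluidPDE

/-! ## §1 Re-centring a schedule; readouts relative to a ball of any centre -/

namespace Schedule

variable {R : TowerRates} (S : Schedule R)

/-- **Re-centring**: the schedule `S` in coordinates centred at `c` — datum `x ↦ u₀ (c + x)`, force
`(t, x) ↦ f t (c + x)` (Clay classes by `HasRapidSpatialDecay.spaceShift`, `IsSmoothOnHalfSpace.spaceShift`,
`HasRapidSpaceTimeDecay.spaceShift`); times, constants, radius and label loops kept. The new ball
`B̄(0, radius)` is the old `B̄(c, radius)`. [cite: FeffermanClay2006, (4)] -/
def translate (c : EuclideanSpace ℝ (Fin 3)) : Schedule R :=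
  { S with
    u₀ := fun x => S.u₀ (c + x)
    f := fun t x => S.f t (c + x)
    datum_decay := S.datum_decay.spaceShift c
    force_smooth := S.force_smooth.spaceShift c
    force_decay := S.force_decay.spaceShift c
    force_silent := fun t ht x => S.force_silent t ht (c + x)
    push_small := fun k t ht x => S.push_small k t ht (c + x) }

/-- Re-centring keeps the readout times. [folklore] -/
@[simp] theorem translate_τ (c : EuclideanSpace ℝ (Fin 3)) : (S.translate c).τ = S.τ := rfl

/-- Re-centring keeps the radius. [folklore] -/
@[simp] theorem translate_radius (c : EuclideanSpace ℝ (Fin 3)) : (S.translate c).radius = S.radius := rfl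

/-- Re-centring keeps the floor constant. [folklore] -/
@[simp] theorem translate_c₁ (c : EuclideanSpace ℝ (Fin 3)) : (S.translate c).c₁ = S.c₁ := rfl

/-- Re-centring keeps the ceiling constant. [folklore] -/
@[simp] theorem translate_c₂ (c : EuclideanSpace ℝ (Fin 3)) : (S.translate c).c₂ = S.c₂ := rfl

/-- The re-centred datum. [folklore] -/
@[simp] theorem translate_u₀ (c : EuclideanSpace ℝ (Fin 3)) :
    (S.translate c).u₀ = fun x => S.u₀ (c + x) := rfl

/-- The re-centred force. [folklore] -/
@[simp] theorem translate_f (c : EuclideanSpace ℝ (Fin 3)) :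
    (S.translate c).f = fun t x => S.f t (c + x) := rfl

/-- **Level `j` is READ inside the ball `B̄(c, r)`** by the velocity slice `w`: the register's three readout
clauses with centre `c` — a point of speed `≥ c₁ Y_j`, a point of strain `≥ c₁ A_j`, and an `N_j`-core loop,
each centred within distance `r` of `c`. At `c = 0` this is `Schedule.ReadsIn`. [cite: Palasek2026ElementaryModel, §3.1] -/
def ReadsInBall (j : ℕ) (c : EuclideanSpace ℝ (Fin 3)) (r : ℝ)
    (w : EuclideanSpace ℝ (Fin 3) → EuclideanSpace ℝ (Fin 3)) : Prop :=
  (∃ x, ‖x - c‖ ≤ r ∧ S.c₁ * R.Y j ≤ ‖w x‖) ∧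
    (∃ x, ‖x - c‖ ≤ r ∧ S.c₁ * R.A j ≤ ‖fderiv ℝ w x‖) ∧
    (∃ (x : EuclideanSpace ℝ (Fin 3)) (γ : ℝ → EuclideanSpace ℝ (Fin 3)),
      ‖x - c‖ ≤ r ∧ ContDiff ℝ 1 γ ∧ γ 0 = γ 1 ∧
      (∀ σ ∈ Icc (0 : ℝ) 1, γ σ ∈ Metric.closedBall x (1 / R.N j)) ∧
      (∀ σ ∈ Icc (0 : ℝ) 1, ‖deriv γ σ‖ ≤ 8 * π / R.N j) ∧
      S.c₁ * R.N j ^ (R.β - 2) ≤ circulation w γ)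

variable {S}

/-- Reading inside `B̄(0, r)` is `Schedule.ReadsIn`. [folklore] -/
theorem readsInBall_zero_iff {j : ℕ} {r : ℝ} {w : EuclideanSpace ℝ (Fin 3) → EuclideanSpace ℝ (Fin 3)} :
    S.ReadsInBall j 0 r w ↔ S.ReadsIn j r w := by
  simp only [ReadsInBall, ReadsIn, sub_zero]

/-- If the speed stays below `c₁ Y_j` throughout `B̄(c, r)`, level `j` is not read there. [folklore] -/
theorem not_readsInBall_of_speed_lt {j : ℕ} {c : EuclideanSpace ℝ (Fin 3)} {r : ℝ}
    {w : EuclideanSpace ℝ (Fin 3) → EuclideanSpace ℝ (Fin 3)}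
    (h : ∀ x, ‖x - c‖ ≤ r → ‖w x‖ < S.c₁ * R.Y j) : ¬ S.ReadsInBall j c r w := fun hr => by
  obtain ⟨⟨x, hx, hge⟩, -, -⟩ := hr
  exact absurd (h x hx) (not_lt.2 hge)

/-- The circulation of a field along a translated loop is that of the translated field.
[folklore] -/
private theorem circulation_const_add_loop (w : EuclideanSpace ℝ (Fin 3) → EuclideanSpace ℝ (Fin 3))
    (γ : ℝ → EuclideanSpace ℝ (Fin 3)) (c : EuclideanSpace ℝ (Fin 3)) :
    circulation w (fun σ => c + γ σ) = circulation (fun y => w (c + y)) γ := by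
  have h1 : (fun σ => c + γ σ) = fun σ => γ σ + c := by funext σ; exact add_comm _ _
  have h2 : (fun y => w (c + y)) = fun y => w (y + c) := by funext y; rw [add_comm]
  rw [h1, h2]
  exact circulation_loop_add_const w γ c

/-- **Reading in `B̄(c, r)` is reading in `B̄(0, r)` for the re-centred slice `y ↦ w (c + y)`**
(`fderiv_comp_add_left`; a core loop `γ` near `y` is the loop `c + γ` near `c + y` with the same speed and,
by `circulation_loop_add_const`, the same circulation). [folklore] -/
theorem readsIn_translate_iff {j : ℕ} {c : EuclideanSpace ℝ (Fin 3)} {r : ℝ}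
    {w : EuclideanSpace ℝ (Fin 3) → EuclideanSpace ℝ (Fin 3)} :
    S.ReadsIn j r (fun y => w (c + y)) ↔ S.ReadsInBall j c r w := by
  have key : ∀ y : EuclideanSpace ℝ (Fin 3), ‖c + y - c‖ = ‖y‖ := fun y => by rw [add_sub_cancel_left]
  have key' : ∀ x : EuclideanSpace ℝ (Fin 3), c + (x - c) = x := fun x => by rw [add_sub_cancel]
  constructor
  · rintro ⟨⟨y, hy, hv⟩, ⟨y', hy', hw⟩, ⟨z, γ, hz, hγ, hcl, hball, hsp, hcirc⟩⟩
    refine ⟨⟨c + y, by rwa [key], hv⟩, ⟨c + y', by rwa [key], by rwa [fderiv_comp_add_left] at hw⟩,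
      ⟨c + z, fun σ => c + γ σ, by rwa [key], contDiff_const.add hγ,
        by show c + γ 0 = c + γ 1; rw [hcl], ?_, ?_, ?_⟩⟩
    · intro σ hσ
      have h := hball σ hσ
      rw [Metric.mem_closedBall, dist_eq_norm] at h ⊢
      rwa [add_sub_add_left_eq_sub]
    · intro σ hσ
      rw [deriv_const_add']
      exact hsp σ hσ
    · rwa [circulation_const_add_loop]
  · rintro ⟨⟨x, hx, hv⟩, ⟨x', hx', hw⟩, ⟨z, γ, hz, hγ, hcl, hball, hsp, hcirc⟩⟩
    refine ⟨⟨x - c, hx, by show _ ≤ ‖w (c + (x - c))‖; rw [key']; exact hv⟩,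
      ⟨x' - c, hx', by
        show _ ≤ ‖fderiv ℝ (fun y => w (c + y)) (x' - c)‖
        rw [fderiv_comp_add_left, key']; exact hw⟩,
      ⟨z - c, fun σ => -c + γ σ, hz, contDiff_const.add hγ,
        by show -c + γ 0 = -c + γ 1; rw [hcl], ?_, ?_, ?_⟩⟩
    · intro σ hσ
      have h := hball σ hσ
      rw [Metric.mem_closedBall, dist_eq_norm] at h ⊢
      have e : -c + γ σ - (z - c) = γ σ - z := by abel
      rwa [e]
    · intro σ hσ
      rw [deriv_const_add']
      exact hsp σ hσ
    · have e : (fun σ => c + (-c + γ σ)) = γ := by funext σ; rw [add_neg_cancel_left]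
      rw [← circulation_const_add_loop, e]
      exact hcirc

/-- **Confinement of the re-centred design** is vanishing of datum and force outside `B̄(c, r)`. [folklore] -/
theorem confinedTo_translate_iff {c : EuclideanSpace ℝ (Fin 3)} {r : ℝ} :
    (S.translate c).ConfinedTo r ↔
      (∀ x, r < ‖x - c‖ → S.u₀ x = 0) ∧ (∀ t x, r < ‖x - c‖ → S.f t x = 0) := by
  have key : ∀ y : EuclideanSpace ℝ (Fin 3), ‖c + y - c‖ = ‖y‖ := fun y => by rw [add_sub_cancel_left]
  have key' : ∀ x : EuclideanSpace ℝ (Fin 3), c + (x - c) = x := fun x => by rw [add_sub_cancel]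
  simp only [ConfinedTo, translate_u₀, translate_f]
  constructor
  · rintro ⟨hu, hf⟩
    exact ⟨fun x hx => by simpa [key'] using hu (x - c) (by simpa using hx),
      fun t x hx => by simpa [key'] using hf t (x - c) (by simpa using hx)⟩
  · rintro ⟨hu, hf⟩
    exact ⟨fun y hy => hu (c + y) (by rwa [key]), fun t y hy => hf t (c + y) (by rwa [key])⟩

/-- **Rigidity does not see the origin.** [folklore] -/
theorem Rigid.translate (h : S.Rigid) (c : EuclideanSpace ℝ (Fin 3)) : (S.translate c).Rigid :=
  ⟨h.window_eq, h.c₅_eq, h.c₁_eq, h.c₂_eq⟩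

/-- **Quietness does not see the origin.** [folklore] -/
theorem Quiet.translate (h : S.Quiet) (c : EuclideanSpace ℝ (Fin 3)) : (S.translate c).Quiet := by
  intro t ht
  funext x
  show S.f t (c + x) = 0
  rw [h t ht]
  rfl

/-- **The pins transport to every re-centred and re-balled schedule whose ball still confines datum and
force** (impulse and separation are coordinate-free). [cite: Palasek2026ElementaryModel, §3.3] -/
theorem Pins.translate_reball {Λ θ : ℝ} (h : S.Pins Λ θ) {c : EuclideanSpace ℝ (Fin 3)} {r : ℝ}
    (hc : (S.translate c).ConfinedTo r) : ((S.translate c).reball r).Pins Λ θ :=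
  ⟨h.impulse, h.sep, hc.1, hc.2⟩

end Schedule

/-! ## §2 Re-centring a registered stage; the re-centred design's flow is the re-centred flow -/

namespace Stage

open Schedule

variable {ν : ℝ} {R : TowerRates} {S : Schedule R} {m : Margins R} {k : ℕ}

/-- Lebesgue measure on `ℝ³` is translation invariant: the energy of a re-centred slice is unchanged.
[folklore] -/
private theorem lintegral_translate (w : EuclideanSpace ℝ (Fin 3) → EuclideanSpace ℝ (Fin 3))
    (c : EuclideanSpace ℝ (Fin 3)) : ∫⁻ y, ‖w (c + y)‖ₑ ^ 2 = ∫⁻ x, ‖w x‖ₑ ^ 2 :=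
  lintegral_add_left_eq_self (μ := volume) (fun x => ‖w x‖ₑ ^ 2) c

/-- **Re-centring a `routeG` stage.** A globally anchored registered stage of `S` at level `k` whose levels
`j ≤ k` are read inside `B̄(c, r)` is, in coordinates centred at `c`, a globally anchored registered stage of
`(S.translate c).reball r` at level `k` (velocity `(t, y) ↦ u t (c + y)`, pressure likewise): the PDE
(`IsClassicalNSSolutionOn.spaceTranslate`), the energy (translation invariance of Lebesgue measure), the
ceilings, the quiet clauses, the global anchor and rigidity see no origin. [cite: Palasek2026ElementaryModel, §3.3] -/
def translate (s : Stage ν R S (Margins.routeG R) k) (c : EuclideanSpace ℝ (Fin 3)) (r : ℝ)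
    (h : ∀ j, j ≤ k → S.ReadsInBall j c r (s.u (S.τ j))) :
    Stage ν R ((S.translate c).reball r) (Margins.routeG R) k where
  u := fun t y => s.u t (c + y)
  p := fun t y => s.p t (c + y)
  classical := s.classical.spaceTranslate c
  initial := by
    funext y
    show s.u 0 (c + y) = S.u₀ (c + y)
    rw [s.initial]
  energy := by
    obtain ⟨C, hC, hb⟩ := s.energy
    refine ⟨C, hC, fun t ht => ?_⟩
    rw [lintegral_translate (s.u t) c]
    exact hb t ht
  floor := fun j hj => (readsIn_translate_iff.2 (h j hj)).1
  ceiling := fun j hj t ht y => s.ceiling j hj t ht (c + y)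
  quiet := fun j hj t ht y => s.quiet j hj t ht (c + y)
  margin :=
    ⟨fun j hj => (readsIn_translate_iff.2 (h j hj)).2.1, fun t ht y => s.routeG_anchorGlobal t ht (c + y),
      (s.routeG_rigid.translate c).reball r, fun j hj => (readsIn_translate_iff.2 (h j hj)).2.2⟩

/-- The re-centred stage's velocity. [folklore] -/
@[simp] theorem translate_u (s : Stage ν R S (Margins.routeG R) k) (c : EuclideanSpace ℝ (Fin 3)) (r : ℝ)
    (h : ∀ j, j ≤ k → S.ReadsInBall j c r (s.u (S.τ j))) :
    (s.translate c r h).u = fun t y => s.u t (c + y) := rfl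

/-- **A stage of the re-centred design pins the ORIGINAL design's flow, re-centred** (no W14): every classical
finite-energy solution `(v, q)` of `S`'s system on `[0, τ k']` from `S`'s Clay datum satisfies
`v t (c + y) = s'.u t y` for every stage `s'` of `(S.translate c).reball r` at level `k'` — translate `(v, q)`
to the new coordinates (`IsClassicalNSSolutionOn.spaceTranslate`, energy by translation invariance) and apply
`Stage.velocity_eq_of_classical`. [cite: Sohr2001, Ch. V Thm. 1.5.1] -/
theorem translated_velocity_eq (hν : 0 < ν) {c : EuclideanSpace ℝ (Fin 3)} {r : ℝ} {k' : ℕ}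
    (s' : Stage ν R ((S.translate c).reball r) m k')
    {v : ℝ → EuclideanSpace ℝ (Fin 3) → EuclideanSpace ℝ (Fin 3)} {q : ℝ → EuclideanSpace ℝ (Fin 3) → ℝ}
    (hv : IsClassicalNSSolutionOn (Icc 0 (S.τ k')) ν S.f v q) (hv0 : v 0 = S.u₀)
    (hEv : ∃ C : ℝ≥0∞, C < ⊤ ∧ ∀ t ∈ Icc 0 (S.τ k'), ∫⁻ x, ‖v t x‖ₑ ^ 2 ≤ C) :
    ∀ t ∈ Icc 0 (S.τ k'), (fun y => v t (c + y)) = s'.u t := by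
  have hv' : IsClassicalNSSolutionOn (Icc 0 (((S.translate c).reball r).τ k')) ν ((S.translate c).reball r).f
      (fun t y => v t (c + y)) (fun t y => q t (c + y)) :=
    hv.spaceTranslate c
  have hv0' : (fun y => v 0 (c + y)) = ((S.translate c).reball r).u₀ := by
    funext y
    show v 0 (c + y) = S.u₀ (c + y)
    rw [hv0]
  have hEv' : ∃ C : ℝ≥0∞, C < ⊤ ∧ ∀ t ∈ Icc 0 (((S.translate c).reball r).τ k'),
      ∫⁻ y, ‖v t (c + y)‖ₑ ^ 2 ≤ C := by
    obtain ⟨C, hC, hb⟩ := hEv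
    exact ⟨C, hC, fun t ht => by rw [lintegral_translate (v t) c]; exact hb t ht⟩
  exact s'.velocity_eq_of_classical hν le_rfl hv' hv0' hEv'

end Stage

/-! ## §3 The lever for balls of any centre -/

section Lever

open Schedule

variable {k : ℕ} {S : Schedule TowerRates.wide}

/-- **THE BALL LEVER, ANY CENTRE.** Under `HeredityAt k`: EVERY registered stage at level `k + 1` (any margins)
of a pinned, rigid, quiet wide design reads level `k + 1` at `τ (k+1)` — speed `≥ c₁ Y_{k+1}`, strain
`≥ c₁ A_{k+1}`, an `N_{k+1}`-core loop — inside EVERY ball `B̄(c, r)` (any centre, any radius; no comparison with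
`S.radius`) that confines `(u₀, f)` and in which the levels `j ≤ k` of some registered level-`k` stage of the
design are read: apply the hypothesis to the re-centred re-balled design `(S.translate c).reball r` and the
re-centred stage, and compare flows by `Stage.translated_velocity_eq` (no W14). [cite: Sohr2001, Ch. V Thm. 1.5.1] -/
theorem HeredityAt.readsInBall (h : HeredityAt k) (hP : S.Pins 8 (6 / 5)) (hR : S.Rigid) (hQ : S.Quiet)
    (s : Stage 1 TowerRates.wide S (Margins.routeG TowerRates.wide) k) {c : EuclideanSpace ℝ (Fin 3)}
    {r : ℝ} (hc : (S.translate c).ConfinedTo r) (hs : ∀ j, j ≤ k → S.ReadsInBall j c r (s.u (S.τ j)))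
    {m' : Margins TowerRates.wide} (s'' : Stage 1 TowerRates.wide S m' (k + 1)) :
    S.ReadsInBall (k + 1) c r (s''.u (S.τ (k + 1))) := by
  obtain ⟨s₂, -⟩ := h ((S.translate c).reball r) (hP.translate_reball hc) ((hR.translate c).reball r)
    ((hQ.translate c).reball r) (s.translate c r hs)
  have heq : (fun y => s''.u (S.τ (k + 1)) (c + y)) = s₂.u (S.τ (k + 1)) :=
    s₂.translated_velocity_eq one_pos s''.classical s''.initial s''.energy (S.τ (k + 1))
      ⟨(S.τ_pos _).le, le_rfl⟩
  have hread : S.ReadsIn (k + 1) r (s₂.u (S.τ (k + 1))) := s₂.readsIn_radius le_rfl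
  rw [← heq] at hread
  exact readsIn_translate_iff.1 hread

/-- **The lever from the level-`(k+1)` stage alone, any centre.** Under `HeredityAt k`, a registered
level-`(k+1)` stage whose own levels `j ≤ k` are read inside an admissible `B̄(c, r)` reads level `k + 1` there
too. [cite: Sohr2001, Ch. V Thm. 1.5.1] -/
theorem HeredityAt.readsInBall' (h : HeredityAt k) (hP : S.Pins 8 (6 / 5)) (hR : S.Rigid) (hQ : S.Quiet)
    (s'' : Stage 1 TowerRates.wide S (Margins.routeG TowerRates.wide) (k + 1)) {c : EuclideanSpace ℝ (Fin 3)}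
    {r : ℝ} (hc : (S.translate c).ConfinedTo r) (hs : ∀ j, j ≤ k → S.ReadsInBall j c r (s''.u (S.τ j))) :
    S.ReadsInBall (k + 1) c r (s''.u (S.τ (k + 1))) :=
  h.readsInBall hP hR hQ (Stage.restrictOfAntitone (Margins.antitone_routeG TowerRates.wide) (Nat.le_succ k) s'')
    hc hs s''

/-- **THE WHOLE TOWER SITS IN EVERY BALL — OF ANY CENTRE — THAT CONFINES THE DESIGN AND READS ITS FIRST
LEVELS.** Under `HeredityFrom k₀`: for every registered stage at any level `K` of a pinned rigid quiet wide
design and every ball `B̄(c, r)` that confines `(u₀, f)` and reads the levels `j ≤ k₀` of the stage, EVERY level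
`j ≤ K` is read inside `B̄(c, r)`. [cite: Sohr2001, Ch. V Thm. 1.5.1] -/
theorem HeredityFrom.readsInBall_all {k₀ : ℕ} (h : HeredityFrom k₀) (hP : S.Pins 8 (6 / 5)) (hR : S.Rigid)
    (hQ : S.Quiet) {K : ℕ} (s : Stage 1 TowerRates.wide S (Margins.routeG TowerRates.wide) K)
    {c : EuclideanSpace ℝ (Fin 3)} {r : ℝ} (hc : (S.translate c).ConfinedTo r)
    (hs : ∀ j, j ≤ k₀ → j ≤ K → S.ReadsInBall j c r (s.u (S.τ j))) :
    ∀ j, j ≤ K → S.ReadsInBall j c r (s.u (S.τ j)) := by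
  induction K with
  | zero =>
    intro j hj
    exact hs j ((Nat.le_zero.1 hj).symm ▸ Nat.zero_le _) hj
  | succ K ih =>
    set sK := Stage.restrictOfAntitone (Margins.antitone_routeG TowerRates.wide) (Nat.le_succ K) s with hsK
    have huK : sK.u = s.u := Stage.restrictOfAntitone_u _ _ _
    have hK : ∀ j, j ≤ K → S.ReadsInBall j c r (s.u (S.τ j)) := by
      have := ih sK (fun j hj hjK => by rw [huK]; exact hs j hj (hjK.trans (Nat.le_succ K)))
      simpa only [huK] using this
    intro j hj
    rcases Nat.lt_or_ge j (K + 1) with hlt | hge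
    · exact hK j (Nat.lt_succ_iff.1 hlt)
    · have hjK : j = K + 1 := le_antisymm hj hge
      subst hjK
      rcases Nat.lt_or_ge K k₀ with hK₀ | hK₀
      · exact hs (K + 1) hK₀ le_rfl
      · exact (h.heredityAt hK₀).readsInBall' hP hR hQ s hc hK

/-- **TEMPLATE (plain-continuation form, any centre).** ONE pinned rigid quiet wide design, ONE registered
level-`k` stage `s`, ONE ball `B̄(c, r)` confining `(u₀, f)` and reading the levels `j ≤ k` of `s`, and ANY
classical finite-energy solution `(v, q)` of the design's system on `[0, τ (k+1)]` from the Clay datum whose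
speed at `τ (k+1)` stays `< c₁ Y_{k+1}` throughout `B̄(c, r)` — refutes `HeredityAt k`. (Vacuity warning: no
registered stage is known.) [cite: Sohr2001, Ch. V Thm. 1.5.1] -/
theorem not_heredityAt_of_continuation_speed_lt_ball (hP : S.Pins 8 (6 / 5)) (hR : S.Rigid) (hQ : S.Quiet)
    (s : Stage 1 TowerRates.wide S (Margins.routeG TowerRates.wide) k) {c : EuclideanSpace ℝ (Fin 3)}
    {r : ℝ} (hc : (S.translate c).ConfinedTo r) (hs : ∀ j, j ≤ k → S.ReadsInBall j c r (s.u (S.τ j)))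
    {v : ℝ → EuclideanSpace ℝ (Fin 3) → EuclideanSpace ℝ (Fin 3)} {q : ℝ → EuclideanSpace ℝ (Fin 3) → ℝ}
    (hv : IsClassicalNSSolutionOn (Icc 0 (S.τ (k + 1))) 1 S.f v q) (hv0 : v 0 = S.u₀)
    (hEv : ∃ C : ℝ≥0∞, C < ⊤ ∧ ∀ t ∈ Icc 0 (S.τ (k + 1)), ∫⁻ x, ‖v t x‖ₑ ^ 2 ≤ C)
    (hesc : ∀ x, ‖x - c‖ ≤ r → ‖v (S.τ (k + 1)) x‖ < S.c₁ * TowerRates.wide.Y (k + 1)) :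
    ¬ HeredityAt k := fun h => by
  obtain ⟨s₂, -⟩ := h ((S.translate c).reball r) (hP.translate_reball hc) ((hR.translate c).reball r)
    ((hQ.translate c).reball r) (s.translate c r hs)
  have heq : (fun y => v (S.τ (k + 1)) (c + y)) = s₂.u (S.τ (k + 1)) :=
    s₂.translated_velocity_eq one_pos hv hv0 hEv (S.τ (k + 1)) ⟨(S.τ_pos _).le, le_rfl⟩
  have hread : S.ReadsIn (k + 1) r (s₂.u (S.τ (k + 1))) := s₂.readsIn_radius le_rfl
  rw [← heq] at hread
  exact not_readsInBall_of_speed_lt hesc (readsIn_translate_iff.1 hread)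

/-- **Item 19249 at any centre.** Under `HeredityAtOne`, every registered level-`2` stage reads level `2` at
`τ₂` inside every ball `B̄(c, r)` that confines `(u₀, f)` and reads the levels `0`, `1` of a registered level-`1`
stage. [cite: Sohr2001, Ch. V Thm. 1.5.1] -/
theorem HeredityAtOne.readsInBall (h : HeredityAtOne) (hP : S.Pins 8 (6 / 5)) (hR : S.Rigid) (hQ : S.Quiet)
    (s : Stage 1 TowerRates.wide S (Margins.routeG TowerRates.wide) 1) {c : EuclideanSpace ℝ (Fin 3)}
    {r : ℝ} (hc : (S.translate c).ConfinedTo r) (hs : ∀ j, j ≤ 1 → S.ReadsInBall j c r (s.u (S.τ j)))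
    {m' : Margins TowerRates.wide} (s'' : Stage 1 TowerRates.wide S m' 2) :
    S.ReadsInBall 2 c r (s''.u (S.τ 2)) :=
  HeredityAt.readsInBall (heredityAtOne_iff.1 h) hP hR hQ s hc hs s''

/-- **Item 19178 at any centre**: under `EpisodeInductionG` the whole tower of every registered stage is read
inside every ball of any centre that confines the design and reads its levels `0` and `1`.
[cite: Sohr2001, Ch. V Thm. 1.5.1] -/
theorem EpisodeInductionG.readsInBall_all (h : EpisodeInductionG) (hP : S.Pins 8 (6 / 5)) (hR : S.Rigid)
    (hQ : S.Quiet) {K : ℕ} (s : Stage 1 TowerRates.wide S (Margins.routeG TowerRates.wide) K)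
    {c : EuclideanSpace ℝ (Fin 3)} {r : ℝ} (hc : (S.translate c).ConfinedTo r)
    (hs : ∀ j, j ≤ 1 → j ≤ K → S.ReadsInBall j c r (s.u (S.τ j))) :
    ∀ j, j ≤ K → S.ReadsInBall j c r (s.u (S.τ j)) :=
  (episodeInductionG_iff_heredityFrom_one.1 h).readsInBall_all hP hR hQ s hc hs

end Lever

end Summit.NavierStokesRegularity.FluidComputer.PalasekTowerClayBridge

end
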